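import Summits.KontsevichZagierPeriods.KontsevichZagierPeriods.Theses.CompiledSubstitutions
import Summits.KontsevichZagierPeriods.KontsevichZagierPeriods.Theorems.TerasomaMultiplicationBetaCancellationStubPiAsArctan

/-!
# `PiNormalisation` (stmt-KontsevichZagierPeriods-3384, route CompiledSubstitutions)

Kontsevich–Zagier's eq. (1): the three one-dimensional textbook representations of `π`,
`[ℝ, dx/(1+x²)]`, `[(-1,1), dx/√(1−x²)]`, `[(-1,1), 2√(1−x²) dx]`, are each equivalent, by the
moves of the Kontsevich–Zagier calculus (`Literature.NumberTheory.Transcendental.KZ.relations`), to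
the closed-unit-disc representation `[{x²+y² ≤ 1}, 1]` — for ANY representations with the displayed
domains and with integrands agreeing with the displayed ones on the domain.

## Proof

Everything but one move is already in the tree:

* `[(-1,1), 1/√(1−x²)] ∼ [(-1,1), 2√(1−x²)]` (Kontsevich–Zagier's own §1.1 Newton–Leibniz example,
  primitive `x√(1−x²)`, plus integrand additivity) and `[(-1,1), 2√(1−x²)] ∼ [disc, 1]` (one
  Newton–Leibniz move along `y`, primitive `F(x,y) = y`, plus the null boundary `x = ±1`) are
  `equivalent_invSqrtRep_twoSqrtRep` and `equivalent_twoSqrtRep_piRep` of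
  `Theorems/BetaCancellation/Negative/PiLink*.lean`;
* `[(-1,1), 2 dt/(1+t²)] ∼ [disc, 1]` is `stub_piAsArctan`
  (`Theorems/TerasomaMultiplicationBetaCancellationStubPiAsArctan.lean`, substitution
  `x = 2t/(1+t²)`);
* representations with the same domain whose integrands agree on it differ by a relation
  (`KZ.of_sub_of_mem_relations_of_eqOn`), which transfers the three pinned statements to
  arbitrary representations with the displayed data.

The new move (§1) is ONE change of variables (rule (2), `KZ.changeOfVariablesRel`): the rational
map `Ψ(t) = 2t/(1−t²)` ("`tan θ` in terms of `tan(θ/2)`") is a bijection of `(-1,1)` onto `ℝ`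
(injective since `Ψ t = Ψ u` forces `(t−u)(1+tu) = 0` with `tu > −1`; onto since
`y = Ψ(y/(1+√(1+y²)))`), with `Ψ'(t) = 2(1+t²)/(1−t²)² > 0` and
`1/(1+Ψ(t)²) = (1−t²)²/(1+t²)²`, so `(1/(1+x²))∘Ψ · |Ψ'| = 2/(1+t²)`: this is
`[(-1,1), 2/(1+t²)] ∼ [ℝ, 1/(1+x²)]`. No definitions are introduced (the substitution and its
derivative are written out), so this is a pure proof file.

References: M. Kontsevich, D. Zagier, *Periods* (2001), §1.1 eq. (1) and the `√(1−x²)` example;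
§1.2 rules (1)–(3).
-/

noncomputable section

namespace Summit.KontsevichZagierPeriods.CompiledSubstitutions.PiNormalisation

open MeasureTheory Set Real
open Literature.NumberTheory.Transcendental
open Literature.NumberTheory.Transcendental.KZ
open Literature.ModelTheory.ExponentialFields (IsSemialgebraic)
open MvPolynomial (aeval X C)
open Summit.KontsevichZagierPeriods.KontsevichZagierPeriods.BetaCancellationNegative
  (symIoo mem_symIoo isSemialgebraic_symIoo integrableOn_symIoo_of_continuous invSqrtRep
    invSqrtRep_integrand_eq twoSqrtRep equivalent_invSqrtRep_twoSqrtRep equivalent_twoSqrtRep_piRep)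
open Summit.KontsevichZagierPeriods.KontsevichZagierPeriods.BetaCancellationLine
  (piArc_mul_lt_one stub_piAsArctan)

/-! ## §1 The substitution `x = 2t/(1−t²)` from `(-1,1)` onto `ℝ` -/

/-- `1 − t² > 0` for `t ∈ (-1,1)`. [folklore] -/
theorem one_sub_sq_pos {t : ℝ} (ht : t ∈ Ioo (-1:ℝ) 1) : 0 < 1 - t ^ 2 := by
  nlinarith [ht.1, ht.2]

/-- `−1 < t u` for `t, u ∈ (-1,1)`. [folklore] -/
theorem neg_one_lt_mul {t u : ℝ} (ht : t ∈ Ioo (-1:ℝ) 1) (hu : u ∈ Ioo (-1:ℝ) 1) : -1 < t * u := by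
  have h : -t ∈ Ioo (-1:ℝ) 1 := ⟨by linarith [ht.2], by linarith [ht.1]⟩
  have := piArc_mul_lt_one h hu
  linarith

/-- `Ψ(t) = 2t/(1−t²)` is injective on `(-1,1)`: `Ψ t = Ψ u` gives `(t − u)(1 + tu) = 0`.
[folklore] -/
theorem tanDouble_injOn :
    InjOn (fun y : Fin 1 → ℝ => (fun _ : Fin 1 => 2 * y 0 / (1 - y 0 ^ 2)))
      {x : Fin 1 → ℝ | x 0 ∈ Set.Ioo (-1:ℝ) 1} := by
  intro x hx y hy hxy
  have e := congrFun hxy 0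
  simp only at e
  have hx' : (0:ℝ) < 1 - x 0 ^ 2 := one_sub_sq_pos hx
  have hy' : (0:ℝ) < 1 - y 0 ^ 2 := one_sub_sq_pos hy
  rw [div_eq_div_iff hx'.ne' hy'.ne'] at e
  have h1 : (x 0 - y 0) * (1 + x 0 * y 0) = 0 := by linear_combination e / 2
  have hlt : -1 < x 0 * y 0 := neg_one_lt_mul hx hy
  rcases mul_eq_zero.1 h1 with h | h
  · funext i
    obtain rfl : i = 0 := Fin.fin_one_eq_zero i
    exact sub_eq_zero.1 h
  · exact absurd h (by linarith)

/-- `Ψ` maps `(-1,1)` ONTO `ℝ`: `y = Ψ (y / (1 + √(1 + y²)))`. [folklore] -/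
theorem tanDouble_image :
    (fun y : Fin 1 → ℝ => (fun _ : Fin 1 => 2 * y 0 / (1 - y 0 ^ 2))) ''
        {x : Fin 1 → ℝ | x 0 ∈ Set.Ioo (-1:ℝ) 1} = univ := by
  refine eq_univ_of_forall fun y => ?_
  set w : ℝ := √(1 + y 0 ^ 2) with hw
  have hu : (0:ℝ) ≤ 1 + y 0 ^ 2 := by positivity
  have hw0 : 0 ≤ w := Real.sqrt_nonneg _
  have hw2 : w ^ 2 = 1 + y 0 ^ 2 := Real.sq_sqrt hu
  have hyw : |y 0| ≤ w := Real.abs_le_sqrt (by linarith [sq_nonneg (y 0)])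
  have h1w : (0:ℝ) < 1 + w := by linarith
  refine ⟨fun _ => y 0 / (1 + w), ?_, ?_⟩
  · show y 0 / (1 + w) ∈ Ioo (-1:ℝ) 1
    constructor
    · rw [lt_div_iff₀ h1w]
      linarith [neg_abs_le (y 0)]
    · rw [div_lt_one h1w]
      linarith [le_abs_self (y 0)]
  · funext i
    obtain rfl : i = 0 := Fin.fin_one_eq_zero i
    have hy2 : y 0 ^ 2 = (w - 1) * (1 + w) := by linear_combination (-1 : ℝ) * hw2
    have hden : 1 - (y 0 / (1 + w)) ^ 2 = 2 / (1 + w) := by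
      rw [div_pow, hy2]
      field_simp
      ring
    show 2 * (y 0 / (1 + w)) / (1 - (y 0 / (1 + w)) ^ 2) = y 0
    rw [hden]
    field_simp

/-- `Ψ` is a `ℚ`-semialgebraic map on `(-1,1)` (a quotient of polynomials whose denominator does
not vanish there). [folklore] -/
theorem tanDouble_isSemialgebraicMapOn :
    IsSemialgebraicMapOn ℚ {x : Fin 1 → ℝ | x 0 ∈ Set.Ioo (-1:ℝ) 1}
      (fun y : Fin 1 → ℝ => (fun _ : Fin 1 => 2 * y 0 / (1 - y 0 ^ 2))) := by
  have hs : IsSemialgebraic ℚ {x : Fin 1 → ℝ | x 0 ∈ Set.Ioo (-1:ℝ) 1} := isSemialgebraic_symIoo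
  refine IsSemialgebraicMapOn.of_forall hs fun _ => ?_
  refine (isSemialgebraicFunOn_aeval_div_aeval hs (2 * X 0) (1 - X 0 ^ 2) fun x hx => ?_).congr
    fun x _ => ?_
  · simp only [map_sub, map_one, map_pow, MvPolynomial.aeval_X]
    exact (one_sub_sq_pos hx).ne'
  · simp

/-- `Ψ` is differentiable on `(-1,1)`, with derivative `Ψ'(t) · id`, `Ψ'(t) = 2(1+t²)/(1−t²)²`,
of determinant `Ψ'(t)`. [folklore] -/
theorem tanDouble_hasFDerivAt (x : Fin 1 → ℝ) :
    ∃ L : (Fin 1 → ℝ) →L[ℝ] (Fin 1 → ℝ),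
      (x 0 ∈ Set.Ioo (-1:ℝ) 1 →
        HasFDerivAt (fun y : Fin 1 → ℝ => (fun _ : Fin 1 => 2 * y 0 / (1 - y 0 ^ 2))) L x) ∧
      L.det = 2 * (1 + x 0 ^ 2) / (1 - x 0 ^ 2) ^ 2 := by
  set c : ℝ := 2 * (1 + x 0 ^ 2) / (1 - x 0 ^ 2) ^ 2 with hc
  refine ⟨c • ContinuousLinearMap.id ℝ (Fin 1 → ℝ), fun hx => ?_, ?_⟩
  · have hg : HasDerivAt (fun t : ℝ => 2 * t / (1 - t ^ 2)) c (x 0) := by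
      have hnum : HasDerivAt (fun t : ℝ => 2 * t) 2 (x 0) := by
        simpa using (hasDerivAt_id (x 0)).const_mul 2
      have hden : HasDerivAt (fun t : ℝ => 1 - t ^ 2) (-(2 * x 0)) (x 0) := by
        simpa using (hasDerivAt_pow 2 (x 0)).const_sub 1
      have hne : (1 - x 0 ^ 2) ≠ 0 := (one_sub_sq_pos hx).ne'
      refine (hnum.div hden hne).congr_deriv ?_
      rw [hc]
      ring
    have h0 : HasFDerivAt (fun y : Fin 1 → ℝ => y 0)
        (ContinuousLinearMap.proj (R := ℝ) (φ := fun _ : Fin 1 => ℝ) 0) x :=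
      hasFDerivAt_apply 0 x
    have h1 := hg.comp_hasFDerivAt x h0
    have h2 : HasFDerivAt (fun y : Fin 1 → ℝ => 2 * y 0 / (1 - y 0 ^ 2))
        (c • ContinuousLinearMap.proj (R := ℝ) (φ := fun _ : Fin 1 => ℝ) 0) x := h1
    rw [hasFDerivAt_pi']
    intro i
    refine h2.congr_fderiv (ContinuousLinearMap.ext fun v => ?_)
    obtain rfl : i = 0 := Fin.fin_one_eq_zero i
    simp [smul_eq_mul]
  · change LinearMap.det ((c • ContinuousLinearMap.id ℝ (Fin 1 → ℝ) : (Fin 1 → ℝ) →L[ℝ] (Fin 1 → ℝ)) :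
      (Fin 1 → ℝ) →ₗ[ℝ] (Fin 1 → ℝ)) = c
    simp only [ContinuousLinearMap.toLinearMap_smul, ContinuousLinearMap.coe_id, LinearMap.det_smul,
      LinearMap.det_id, Module.finrank_fin_fun, pow_one, mul_one]

/-- The pull-back identity of the substitution, Jacobian included:
`(1/(1 + Ψ(t)²)) · Ψ'(t) = 2/(1+t²)` on `(-1,1)` (`1 + Ψ(t)² = (1+t²)²/(1−t²)²`). [folklore] -/
theorem tanDouble_pullback {t : ℝ} (ht : t ∈ Ioo (-1:ℝ) 1) :
    1 / (1 + (2 * t / (1 - t ^ 2)) ^ 2) * (2 * (1 + t ^ 2) / (1 - t ^ 2) ^ 2) =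
      2 / (1 + t ^ 2) := by
  have hpos : (0:ℝ) < 1 + t ^ 2 := by positivity
  have hmt : (0:ℝ) < 1 - t ^ 2 := one_sub_sq_pos ht
  have hsq : 1 + (2 * t / (1 - t ^ 2)) ^ 2 = ((1 + t ^ 2) / (1 - t ^ 2)) ^ 2 := by
    field_simp
    ring
  rw [hsq]
  field_simp

/-- **The new move** (rule (2)): for `T = [(-1,1), 2/(1+t²)]` and any representation `r` with
domain `ℝ` and integrand `1/(1+x²)` on it, the substitution `x = 2t/(1−t²)` gives
`[T] − [r] ∈ KZ.relations`, i.e. `T ∼ r`. [cite: KontsevichZagier2001, §1.2 rule (2)] -/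
theorem equivalent_of_tanDouble (T r : IntegralRep 1) (hTd : T.domain = {x | x 0 ∈ Set.Ioo (-1:ℝ) 1})
    (hTi : T.integrand = fun x => 2 / (1 + x 0 ^ 2)) (hrd : r.domain = univ)
    (hri : EqOn r.integrand (fun x => 1 / (1 + x 0 ^ 2)) r.domain) : Equivalent T r := by
  choose Φ' hD hdet using tanDouble_hasFDerivAt
  have himage : r.domain =
      (fun y : Fin 1 → ℝ => (fun _ : Fin 1 => 2 * y 0 / (1 - y 0 ^ 2))) '' T.domain := by
    rw [hTd, tanDouble_image, hrd]
  exact changeOfVariablesRel_subset_relations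
    ⟨1, T, r, fun y : Fin 1 → ℝ => (fun _ : Fin 1 => 2 * y 0 / (1 - y 0 ^ 2)), Φ',
      by rw [hTd]; exact tanDouble_isSemialgebraicMapOn,
      fun x hx => (hD x (by rw [hTd] at hx; exact hx)).hasFDerivWithinAt,
      by rw [hTd]; exact tanDouble_injOn, himage, fun x hx => by
        have ht : x 0 ∈ Ioo (-1:ℝ) 1 := by rw [hTd] at hx; exact hx
        have hΨx : (fun _ : Fin 1 => 2 * x 0 / (1 - x 0 ^ 2)) ∈ r.domain := by
          rw [hrd]; exact mem_univ _
        have hc : (0:ℝ) < 2 * (1 + x 0 ^ 2) / (1 - x 0 ^ 2) ^ 2 := by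
          have : (0:ℝ) < 1 - x 0 ^ 2 := one_sub_sq_pos ht
          positivity
        rw [hTi, hri hΨx, hdet x, abs_of_pos hc]
        exact (tanDouble_pullback ht).symm, rfl⟩

/-- The arctangent representation `[(-1,1), 2 dt/(1+t²)]` exists. [folklore] -/
theorem exists_arctanRep :
    ∃ T : IntegralRep 1, T.domain = {x | x 0 ∈ Set.Ioo (-1:ℝ) 1} ∧
      T.integrand = fun x => 2 / (1 + x 0 ^ 2) := by
  have hsa : IsSemialgebraicFunOn ℚ symIoo (fun x : Fin 1 → ℝ => 2 / (1 + x 0 ^ 2)) := by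
    refine (isSemialgebraicFunOn_aeval_div_aeval isSemialgebraic_symIoo
      (MvPolynomial.C 2 : MvPolynomial (Fin 1) ℚ) (1 + MvPolynomial.X 0 ^ 2) fun x _ => ?_).congr
      fun x _ => ?_
    · simp only [map_add, map_one, map_pow, MvPolynomial.aeval_X]
      positivity
    · simp only [map_add, map_one, map_pow, MvPolynomial.aeval_X, MvPolynomial.aeval_C,
        eq_ratCast, Rat.cast_ofNat]
  have hc : Continuous fun x : Fin 1 → ℝ => 2 / (1 + x 0 ^ 2) :=
    Continuous.div continuous_const (by fun_prop) fun x => by positivity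
  exact ⟨⟨symIoo, fun x => 2 / (1 + x 0 ^ 2), isSemialgebraic_symIoo, hsa,
    integrableOn_symIoo_of_continuous hc⟩, rfl, rfl⟩

/-! ## §2 The item -/

/-- **`PiNormalisation`** (item stmt-KontsevichZagierPeriods-3384 of route CompiledSubstitutions;
Kontsevich–Zagier 2001, eq. (1)): for every representation `p` with domain the closed unit disc
`{x² + y² ≤ 1}` and integrand `1` on it, each of the three one-dimensional representations of `π`
— `[ℝ, 1/(1+x²)]`, `[(-1,1), 1/√(1−x²)]`, `[(-1,1), 2√(1−x²)]` (any representation with that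
domain and an integrand agreeing with the displayed one on it) — is `KZ.Equivalent` to `p`.
Chains: `1/(1+x²) —(x = 2t/(1−t²))→ 2/(1+t²) —(x = 2t/(1+t²))→ 1/√(1−x²) —(KZ §1.1 Newton–Leibniz,
primitive x√(1−x²))→ 2√(1−x²) —(Newton–Leibniz along y, primitive y; null boundary x = ±1)→ disc`.
[cite: KontsevichZagier2001, §1.1 eq. (1)] -/
theorem piNormalisation_proof :
    Summit.KontsevichZagierPeriods.KontsevichZagierPeriods.Theses.CompiledSubstitutions.PiNormalisation := by
  intro p hpd hpi
  -- `[p] − [piRep]` is a relation: same domain, same integrand on it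
  have hP : Equivalent p piRep :=
    of_sub_of_mem_relations_of_eqOn (by rw [hpd]; rfl) fun z hz => (hpi hz).trans rfl
  refine ⟨fun r hrd hri => ?_, fun r hrd hri => ?_, fun r hrd hri => ?_⟩
  · -- `[ℝ, 1/(1+x²)] ∼ [(-1,1), 2/(1+t²)] ∼ disc`
    obtain ⟨T, hTd, hTi⟩ := exists_arctanRep
    have h1 : Equivalent r T := (equivalent_of_tanDouble T r hTd hTi hrd hri).symm
    exact h1.trans (stub_piAsArctan T p hTd (fun x _ => by rw [hTi]) hpd hpi)
  · -- `[(-1,1), 1/√(1−x²)] ∼ invSqrtRep ∼ twoSqrtRep ∼ piRep ∼ p`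
    have h1 : Equivalent r invSqrtRep :=
      of_sub_of_mem_relations_of_eqOn (by rw [hrd]; rfl) fun x hx => by
        have hx' : x ∈ symIoo := by rw [hrd] at hx; exact hx
        rw [hri hx, invSqrtRep_integrand_eq hx']
        simp only [one_div]
    exact ((h1.trans equivalent_invSqrtRep_twoSqrtRep).trans equivalent_twoSqrtRep_piRep).trans
      hP.symm
  · -- `[(-1,1), 2√(1−x²)] ∼ twoSqrtRep ∼ piRep ∼ p`
    have h1 : Equivalent r twoSqrtRep :=
      of_sub_of_mem_relations_of_eqOn (by rw [hrd]; rfl) fun x hx => (hri hx).trans rfl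
    exact (h1.trans equivalent_twoSqrtRep_piRep).trans hP.symm

end Summit.KontsevichZagierPeriods.CompiledSubstitutions.PiNormalisation

end
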